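import Summits.ResolutionOfSingularities.ResolutionOfSingularities.Theorems.SubfieldContactAbs
import HarnessLib

/-!
# SubfieldContactPowAdjoin — decomp-res node «SubfieldContact» (lens-6 g19, critic rows 147/147b/147c/147d),
tree file 4/6 of the node

Content VERBATIM from the decomp-res lens-6 g19 node file `HOME/decomp-res-lens-6/g19/SubfieldContact.lean` (rev 2
pin cc5614fe…, 933 l (append-only superset of rev 1 ba733ec4: +§11);
= `parts/SubfieldContact-g19-rev2-cc5614fe.lean`; HOME = run/shared/lean/pub/decomp-res).  Critic: CRITIC-LEDGER
rows 147 (node 90f156f3 CLEARED) and 147b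
(rev 1 = MAP +1, window (M2) consumed; «rev 1 ba733ec4 SUPERSEDES 90f156f3 as the source of
Theorems/SubfieldContactClasses», order 2026-08-30T22:19:25Z).
Landed by decomp-res writer g8 in the lens's namespace `…Theorems.SubfieldContactClasses`, split CONE-AWARE for
the 400-line limit: `SubfieldContactClasses`
(§1–§6), `SubfieldContactFrames` (§7), `SubfieldContactAbs` (§8–§9), `SubfieldContactPowAdjoin` (§10) are
OUTSIDE the Theses cone (the lens's cone import
`MaxContactCutTauLadder` is used only by the «…_of_items» / «…_of_pieces» up-links from the MaxContactCut
items, which live in the in-cone wiring file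
`MaxContactCutSubfieldContact`).  All `--supports stmt-ResolutionOfSingularities-29273` (`RungOne` = `E 2 → E 1`).
 Route bookkeeping (critic rows 147/147b):
ONE located-residual aside `E1NoSubDvd` (home `SubfieldContactClasses`) on 29273; the NEW LEMMA `SubfieldContactAbs`
(skeleton §9 BY NAME: stubs
`StalkSubfieldContactAbs` / `ContactSpreads` / `SubfieldContactGlue`, `PowAdjoinBase` PROVED by
`powAdjoinBase_holds`) is booked as the prover target (kind aside
under the NAMED-RUNG RULE — outside the cone of `closes`); `SubfieldContact` is its kernel corollary
(`subfieldContact_of_abs`) and is NOT served separately.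
rev 2 (cc5614fe, critic row 147c, order 2026-08-30T22:30:05Z: «supersedes rev 1 as source; land §10–§11») adds
§11 PIECE C PROVED (`subfieldContactGlue_holds`) to file 4/6;
PIECE L2 `ContactSpreads` PROVED (lens-6 g19 `parts/PieceL2-g19-52cf1017.lean`, critic row 147d, order 22:50:05Z
(2): «fold contactSpreads_holds + helpers into the pieces landing in the node
namespace, drop the scratch copies of the definitions») is file 5/6 `SubfieldContactSpreads`; so the support item
`SubfieldContactAbs` is left with the SINGLE stub `StalkSubfieldContactAbs`
(composition: `subfieldContactAbs_of_pieces'' h contactSpreads_holds`).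

§10 (rev 1) PIECE F PROVED: `pow_mem_powAdjoin`, `subset_powAdjoin`, `powAdjoin_eq_top_of_isPBasis`,
`powAdjoin_pow_eq_top_of_isPBasis`,
`module_finite_powAdjoin_diff`, `powAdjoinBase_holds : PowAdjoinBase`; the three-piece compositions
`subfieldContact_of_pieces'` /
`subfieldContactAbs_of_pieces'`.  §11 (rev 2) PIECE C PROVED: `subfieldContactGlue_holds : SubfieldContactGlue`,
two-piece compositions `…_of_pieces''`.  0 sorry.  Imports `SubfieldContactAbs`.  Cone-free.

[WRITER NOTE (decomp-res writer g8): section split only; namespace, opens, section variables and every declaration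
exactly as in the lens (global
`set_option` dropped; the cone import replaced in the cone-free files by the cone-free `WeakOrderReduction`, already
under `PurityValveClasses`).]

(Sources: EGAIV4 §16.8; Matsumura1987 §26, Thm 30.6; Giraud1975; EncinasVillamayor2000GoodPoints §4;
BierstoneGrigorievMilmanWlodarczyk2011 §3; CossartJannsenSaito2020 Thm 1.4; CossartPiltant2008I Thm 2.1;
Cossart2011WeakMaximalContact; CossartPiltant2019; Kollar2007 §3.9.)
-/

noncomputable section

namespace Summit.ResolutionOfSingularities.ResolutionOfSingularities.Theorems.SubfieldContactClasses

open CategoryTheory AlgebraicGeometry TopologicalSpace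
open Literature.AlgebraicGeometry.Resolution
open Summit.ResolutionOfSingularities.ResolutionOfSingularities.Theorems
open WeakOrderReduction ForcedTowerClasses PurityValveClasses

/-! ## §10 (rev 1) PIECE F PROVED: `k` has finite degree over `k^{(p^n)}(B ∖ S)` for an absolute `p`-basis `B` and a
finite `S`, so the structure map over that subfield is again separated, locally of finite type and quasi-compact -/

section PieceF

variable {k : Type} [Field k]

/-- `x^q ∈ k^{(q)}(Λ)`. [folklore] -/
theorem pow_mem_powAdjoin (q : ℕ) (Λ : Set k) (x : k) : x ^ q ∈ powAdjoin k q Λ :=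
  Subfield.subset_closure (Set.mem_union_left _ ⟨x, rfl⟩)

/-- `Λ ⊆ k^{(q)}(Λ)`. [folklore] -/
theorem subset_powAdjoin (q : ℕ) (Λ : Set k) : Λ ⊆ (powAdjoin k q Λ : Set k) :=
  fun _ hx => Subfield.subset_closure (Set.mem_union_right _ hx)

/-- A `p`-basis generates: `k^{(p)}(B) = k`. (Sources: Matsumura1987, §26 p. 202.) -/
theorem powAdjoin_eq_top_of_isPBasis {p : ℕ} {B : Set k} (hB : IsPBasis p k B) : powAdjoin k p B = ⊤ := by
  rw [eq_top_iff]
  intro x _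
  have hx : x ∈ (IntermediateField.adjoin (↥(powAdjoin k p ∅)) B).toSubfield := by
    rw [hB.2, IntermediateField.top_toSubfield]; exact Subfield.mem_top x
  rw [IntermediateField.adjoin_toSubfield] at hx
  refine Subfield.closure_le.mpr ?_ hx
  rintro y (⟨z, rfl⟩ | hy)
  · exact powAdjoin_mono k p (Set.empty_subset B) z.2
  · exact subset_powAdjoin p B hy

/-- Iterating: `k^{(p^{m+1})}(B) = k` for every `m` (`k = k^p(B) ⇒ k^p = k^{p²}(B^p) ⇒ k = k^{p²}(B) ⇒ …`;
the set of `x`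
with `x^p ∈ k^{(p^{m+2})}(B)` is the preimage subfield under Frobenius). (Sources: Matsumura1987, §26 p. 202.) -/
theorem powAdjoin_pow_eq_top_of_isPBasis {p : ℕ} (hp : p.Prime) [CharP k p] {B : Set k} (hB : IsPBasis p k B) :
    ∀ m : ℕ, powAdjoin k (p ^ (m + 1)) B = ⊤ := by
  haveI : ExpChar k p := ExpChar.prime hp
  intro m
  induction m with
  | zero => simpa using powAdjoin_eq_top_of_isPBasis hB
  | succ m ih =>
    have key : ∀ x : k, x ^ p ∈ powAdjoin k (p ^ (m + 1 + 1)) B := by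
      intro x
      have hx : x ∈ powAdjoin k (p ^ (m + 1)) B := by rw [ih]; exact Subfield.mem_top x
      have hle : powAdjoin k (p ^ (m + 1)) B ≤ (powAdjoin k (p ^ (m + 1 + 1)) B).comap (frobenius k p) := by
        refine Subfield.closure_le.mpr ?_
        rintro y (⟨z, rfl⟩ | hy)
        · show frobenius k p (z ^ p ^ (m + 1)) ∈ powAdjoin k (p ^ (m + 1 + 1)) B
          rw [frobenius_def, ← pow_mul, ← pow_succ]
          exact pow_mem_powAdjoin _ _ z
        · show frobenius k p y ∈ powAdjoin k (p ^ (m + 1 + 1)) B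
          rw [frobenius_def]
          exact pow_mem (subset_powAdjoin _ _ hy) p
      have := hle hx
      rwa [Subfield.mem_comap, frobenius_def] at this
    rw [eq_top_iff, ← powAdjoin_eq_top_of_isPBasis hB]
    refine Subfield.closure_le.mpr ?_
    rintro y (⟨z, rfl⟩ | hy)
    · exact key z
    · exact subset_powAdjoin _ _ hy

/-- **finite codegree**: for an absolute `p`-basis `B`, a finite `S` and `n ≥ 1`, `k` is a finite extension of
`k^{(p^n)}(B ∖ S)` (it is generated by `S`, each element of which has its `p^n`-th power in the subfield).
(Sources: Matsumura1987, §26 p. 202.) -/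
theorem module_finite_powAdjoin_diff {p : ℕ} (hp : p.Prime) [CharP k p] {n : ℕ} (hn : 1 ≤ n) {B : Set k}
    (hB : IsPBasis p k B) (S : Finset k) : Module.Finite (↥(powAdjoin k (p ^ n) (B \ ↑S))) k := by
  obtain ⟨m, rfl⟩ : ∃ m, n = m + 1 := ⟨n - 1, by omega⟩
  set F : Subfield k := powAdjoin k (p ^ (m + 1)) (B \ ↑S) with hF
  have hpow : powAdjoin k (p ^ (m + 1)) B = ⊤ := powAdjoin_pow_eq_top_of_isPBasis hp hB m
  have hle : powAdjoin k (p ^ (m + 1)) B ≤ (IntermediateField.adjoin F (S : Set k)).toSubfield := by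
    refine Subfield.closure_le.mpr ?_
    rintro y (⟨z, rfl⟩ | hyB)
    · exact (IntermediateField.adjoin F (S : Set k)).algebraMap_mem ⟨z ^ p ^ (m + 1), pow_mem_powAdjoin _ _ z⟩
    · by_cases hyS : y ∈ S
      · exact IntermediateField.subset_adjoin F (S : Set k) (Finset.mem_coe.mpr hyS)
      · exact (IntermediateField.adjoin F (S : Set k)).algebraMap_mem
          ⟨y, subset_powAdjoin _ _ ⟨hyB, fun h => hyS (Finset.mem_coe.mp h)⟩⟩
  have htop : IntermediateField.adjoin F (S : Set k) = ⊤ := by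
    rw [eq_top_iff]
    intro x _
    exact hle (show x ∈ powAdjoin k (p ^ (m + 1)) B by rw [hpow]; exact Subfield.mem_top x)
  have hint : ∀ x ∈ (S : Set k), IsIntegral F x := fun x _ =>
    IsIntegral.of_pow (pow_pos hp.pos (m + 1)) (by
      have : x ^ p ^ (m + 1) = algebraMap F k ⟨x ^ p ^ (m + 1), pow_mem_powAdjoin _ _ x⟩ := rfl
      rw [this]; exact isIntegral_algebraMap)
  have hfd : FiniteDimensional F (IntermediateField.adjoin F (S : Set k)) :=
    IntermediateField.finiteDimensional_adjoin hint
  rw [htop] at hfd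
  exact IntermediateField.topEquiv.toLinearEquiv.finiteDimensional

/-- **PIECE F PROVED · `powAdjoinBase_holds : PowAdjoinBase`** (finite ⇒ finite type ⇒ `Spec k → Spec k^{(p^n)}(B ∖ S)`
locally of finite type, and affine; compositions). [folklore] -/
theorem powAdjoinBase_holds : PowAdjoinBase := by
  intro p hp n hn k _ _ Y g hB B hBasis S hSB
  haveI hfin : Module.Finite (↥(powAdjoin k (p ^ n) (B \ ↑S))) k := module_finite_powAdjoin_diff hp hn hBasis S
  set F : Subfield k := powAdjoin k (p ^ n) (B \ ↑S) with hF
  haveI : IsSeparated g := hB.isSeparated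
  haveI : LocallyOfFiniteType g := hB.locallyOfFiniteType
  haveI : QuasiCompact g := hB.quasiCompact
  have hft : (CommRingCat.ofHom F.subtype).hom.FiniteType := by
    show (algebraMap F k).FiniteType
    exact RingHom.finiteType_algebraMap.mpr inferInstance
  haveI : LocallyOfFiniteType (Spec.map (CommRingCat.ofHom F.subtype)) := HasRingHomProperty.Spec_iff.mpr hft
  show IsSeparated (g ≫ Spec.map (CommRingCat.ofHom F.subtype)) ∧
    LocallyOfFiniteType (g ≫ Spec.map (CommRingCat.ofHom F.subtype)) ∧
      QuasiCompact (g ≫ Spec.map (CommRingCat.ofHom F.subtype))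
  exact ⟨inferInstance, inferInstance, inferInstance⟩

end PieceF

/-- **THE COMPOSITION with PIECE F discharged (kernel)**: `StalkSubfieldContact → ContactSpreads → SubfieldContactGlue →
SubfieldContact`. [folklore] -/
theorem subfieldContact_of_pieces' (hL1 : StalkSubfieldContact) (hL2 : ContactSpreads) (hC : SubfieldContactGlue) :
    SubfieldContact :=
  subfieldContact_of_pieces hL1 powAdjoinBase_holds hL2 hC

/-- … and at all markings: `StalkSubfieldContactAbs → ContactSpreads → SubfieldContactGlue → SubfieldContactAbs`.
[folklore] -/
theorem subfieldContactAbs_of_pieces' (hL1 : StalkSubfieldContactAbs) (hL2 : ContactSpreads) (hC : SubfieldContactGlue) :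
    SubfieldContactAbs :=
  subfieldContactAbs_of_pieces hL1 powAdjoinBase_holds hL2 hC

/-! ## §11 (rev 2) PIECE C PROVED — `SubfieldContactGlue` (pure topology + the two proved node lemmas).
`Top = {ord ≥ n}` is compact (the scheme is Noetherian: locally of finite type and quasi-compact over a field —
Mathlib `LocallyOfFiniteType.isLocallyNoetherian`, `QuasiCompact.compactSpace_of_compactSpace`, and every subset of a
Noetherian space is compact); every top point `z` specialises to a CLOSED point `y` (Mathlib
`LocallyOfFiniteType.jacobsonSpace`, `nonempty_inter_closedPoints`), which is again a top point (the order does not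
drop under specialisation on a regular scheme: tree `idealOrder_le_of_specializes`) and whose open neighbourhood `U_y`
contains `z`; a finite subcover, `S := ⋃ Sᵢ`, `powAdjoin_mono` + `isContactPt_strOver_mono` (PIECE R) move every local
contact down to `F := k^{(p^n)}(B ∖ S)`, and PIECE F (`powAdjoinBase_holds`) gives the three morphism properties. -/

section PieceC

/-- **PIECE C PROVED (kernel)**: `SubfieldContactGlue`. [folklore] -/
theorem subfieldContactGlue_holds : SubfieldContactGlue := by
  intro p hp n hn k _ _ Y g hB I hord B hBasis hloc
  classical
  haveI := hB.locallyOfFiniteType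
  haveI := hB.quasiCompact
  -- the top locus is compact (`Y` is a Noetherian scheme)
  set Top : Set Y := {y : Y | ((n : ℕ) : ℕ∞) ≤ idealOrder I y} with hTop
  have hcpt : IsCompact Top := by
    haveI : IsLocallyNoetherian Y := LocallyOfFiniteType.isLocallyNoetherian g
    haveI : CompactSpace Y := QuasiCompact.compactSpace_of_compactSpace g
    haveI : IsNoetherian Y := {}
    exact NoetherianSpace.isCompact Top
  -- closed top points, their finite exceptional sets `S y` and neighbourhoods `U y`
  haveI : JacobsonSpace Y := LocallyOfFiniteType.jacobsonSpace g
  let ι := {y : Y // IsClosed ({y} : Set Y) ∧ idealOrder I y = ((n : ℕ) : ℕ∞)}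
  choose S hSB U hyU hU using fun i : ι => hloc i.1 i.2.1 i.2.2
  -- every top point specialises to a closed top point, hence lies in its neighbourhood
  have hcover : Top ⊆ ⋃ i : ι, (U i : Set Y) := by
    intro z hz
    obtain ⟨y, hyz, hyc⟩ := nonempty_inter_closedPoints (Z := closure ({z} : Set Y))
      ⟨z, subset_closure rfl⟩ isClosed_closure.isLocallyClosed
    have hzy : z ⤳ y := specializes_iff_mem_closure.mpr hyz
    have hyT : idealOrder I y = ((n : ℕ) : ℕ∞) := by
      haveI := hB.isRegular y
      exact le_antisymm (hord y) (le_trans hz (idealOrder_le_of_specializes hzy I))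
    exact Set.mem_iUnion.mpr ⟨⟨y, hyc, hyT⟩, hzy.mem_open (U _).isOpen (hyU _)⟩
  obtain ⟨T, hT⟩ := hcpt.elim_finite_subcover (fun i : ι => (U i : Set Y)) (fun i => (U i).isOpen) hcover
  -- the common cofinite subfield `F := k^{(p^n)}(B ∖ ⋃_{i ∈ T} S i)`
  let Stot : Finset k := T.biUnion S
  have hStotB : (↑Stot : Set k) ⊆ B := by
    intro s hs
    obtain ⟨i, -, hi⟩ := Finset.mem_biUnion.mp (Finset.mem_coe.mp hs)
    exact hSB i hi
  set F : Subfield k := powAdjoin k (p ^ n) (B \ ↑Stot) with hFdef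
  have hle : ∀ i ∈ T, F ≤ powAdjoin k (p ^ n) (B \ ↑(S i)) := fun i hi =>
    powAdjoin_mono k (p ^ n) (Set.sdiff_subset_sdiff_right (Finset.coe_subset.mpr (Finset.subset_biUnion_of_mem S hi)))
  obtain ⟨hsep, hlft, hqc⟩ := powAdjoinBase_holds p hp n hn k Y g hB B hBasis Stot hStotB
  haveI : CharP (↥F) p := F.subtype.charP F.subtype.injective p
  refine ⟨↥F, inferInstance, inferInstance, strOver g F, hsep, hlft, hqc, fun y' hy' => ?_⟩
  obtain ⟨i, hi, hyi⟩ := Set.mem_iUnion₂.mp (hT (show y' ∈ Top from hy'.ge))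
  exact isContactPt_strOver_mono g (hle i hi) I n y' (hU i y' hyi hy')

end PieceC

/-- **THE COMPOSITION with PIECES F and C discharged (kernel)**: `StalkSubfieldContact → ContactSpreads → SubfieldContact`
— the coprime law now rests on the NEW CORE (L1) and the spreading step (L2) only. [folklore] -/
theorem subfieldContact_of_pieces'' (hL1 : StalkSubfieldContact) (hL2 : ContactSpreads) : SubfieldContact :=
  subfieldContact_of_pieces' hL1 hL2 subfieldContactGlue_holds

/-- … and at all markings: `StalkSubfieldContactAbs → ContactSpreads → SubfieldContactAbs`. [folklore] -/
theorem subfieldContactAbs_of_pieces'' (hL1 : StalkSubfieldContactAbs) (hL2 : ContactSpreads) : SubfieldContactAbs :=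
  subfieldContactAbs_of_pieces' hL1 hL2 subfieldContactGlue_holds

end Summit.ResolutionOfSingularities.ResolutionOfSingularities.Theorems.SubfieldContactClasses
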